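import Summits.QuantumAdvantage.AdviceFreeQNC0.CodegTwoRows
import Literature.Computability.MetaComplexity.LowDegFlatIndicator
import HarnessLib

/-!
# Cell qa-qnc0 (rung F-S1, route RingFrame, crux α, line `tensor`): R1U at co-degree two, sharp form,
# part 1 — planes of zero-sum quadruples, their moment forms, and the ALGEBRAIC CLIQUE LEMMA

Towards planner qa-qnc0-p2's verbatim THEOREM E2 `CostBoundCodegTwo` (transversal `≤ 6m + 4`): the
kernel `K` of the parity/point-sum map on the row-syndrome space consists of syndromes of ZERO-SUM
QUADRUPLES `a = {p, q, r, p+q+r} = p + S`, `S = {0, x, y, x+y}` (`x = p+q`, `y = p+r`) a PLANE.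

* `Syndrome2.bform x y = x yᵀ + y xᵀ` — the moment matrix of such a quadruple (`quad_structure`:
  from `#a = 4` and zero point-sums, produce `p ∈ a` and `x, y` (non-zero, distinct) with
  `momMat (syn2 𝟙_a) = bform x y` and `a = {v : v̂ + p̂ ∈ span{x,y}}`).
* `Syndrome2.planePts x y` — the four points of the plane `span{x, y}` THROUGH THE ORIGIN;
  `indF_add_indF_planePts_mem_lowDeg`: `𝟙_a + 𝟙_{planePts} ∈ RM(m−3, m)` (it is `0` or the
  indicator of the `3`-space `span{x, y, p̂}` — MacWilliams–Sloane Ch.13 Thm 7, the tree's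
  `Smolensky.indicator_coset_mem_lowDeg`), so the plane through `0` represents the same coset.
* `Syndrome2.four_le_rank_bform_add` — **ALGEBRAIC CLIQUE LEMMA**: if `x, y, x', y'` are linearly
  independent then `bform x y + bform x' y'` has rank `≥ 4` (all four vectors lie in its range, by
  solving `[y x y' x']·e = e_i`).  Hence two kernel planes whose syndromes add to a rank-`≤ 2` moment
  matrix cannot be complementary: they MEET (`CodegTwoStar.lean`), with no Kasami–Tokura step.

Part 2 (`CodegTwoStar.lean`) applies `planes_star_or_top` (p504168) and builds the `6m + 4` transversal.
The cell's lemmas (planner qa-qnc0-p2 gen 5 ROUND-5 §2.2; prover qa-qnc0-prover gen 6, 2026-08-27).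
WHAT THIS IS NOT: no statement about rows yet; nothing on α or the separation.
References: MacWilliams–Sloane (1977) Ch. 13 §4 Thm 7 [MacWilliamsSloane1977] (via `indicator_coset_mem_lowDeg`).
-/

noncomputable section

namespace Summit.QuantumAdvantage.AdviceFreeQNC0

open Finset Module Matrix
open Literature.Computability.MetaComplexity Literature.Computability.MetaComplexity.Smolensky

namespace Syndrome2

variable {m : ℕ}
/-! ### Points and vectors -/

/-- the point of `{0,1}^m` with coordinate vector `z ∈ 𝔽₂^m` (inverse of `bvec`). -/
def toPt (z : Fin m → ZMod 2) : Fin m → Bool := fun i => decide (z i = 1)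

/-- `bvec ∘ toPt = id`. -/
theorem bvec_toPt (z : Fin m → ZMod 2) : bvec (toPt z) = z := by
  funext i
  unfold bvec toPt
  have h : ∀ c : ZMod 2, (if decide (c = 1) = true then (1 : ZMod 2) else 0) = c := by decide
  exact h (z i)

/-- `toPt ∘ bvec = id`. -/
theorem toPt_bvec (v : Fin m → Bool) : toPt (bvec v) = v := by
  funext i
  show decide ((if v i = true then (1 : ZMod 2) else 0) = 1) = v i
  cases v i <;> decide

/-- In `𝔽₂^m`, `z + z = 0`. -/
theorem add_self_vec (z : Fin m → ZMod 2) : z + z = 0 := by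
  funext i; simp only [Pi.add_apply, Pi.zero_apply, CharTwo.add_self_eq_zero]

/-! ### Planes over `𝔽₂` -/

/-- Membership in the span of two vectors over `𝔽₂`: the four combinations. -/
theorem mem_span_pair_iff (x y z : Fin m → ZMod 2) :
    z ∈ Submodule.span (ZMod 2) (Set.range ![x, y]) ↔ z = 0 ∨ z = x ∨ z = y ∨ z = x + y := by
  rw [Submodule.mem_span_range_iff_exists_fun]
  constructor
  · rintro ⟨c, hc⟩
    rw [Fin.sum_univ_two] at hc
    simp only [Matrix.cons_val_zero, Matrix.cons_val_one] at hc
    have h0 : c 0 = 0 ∨ c 0 = 1 := by generalize c 0 = t; revert t; decide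
    have h1 : c 1 = 0 ∨ c 1 = 1 := by generalize c 1 = t; revert t; decide
    rcases h0 with h0 | h0 <;> rcases h1 with h1 | h1 <;> simp only [h0, h1, zero_smul, one_smul,
      zero_add, add_zero] at hc
    · exact Or.inl hc.symm
    · exact Or.inr (Or.inr (Or.inl hc.symm))
    · exact Or.inr (Or.inl hc.symm)
    · exact Or.inr (Or.inr (Or.inr hc.symm))
  · rintro (h | h | h | h) <;> [exact ⟨![0, 0], by rw [Fin.sum_univ_two]; simp [h]⟩;
      exact ⟨![1, 0], by rw [Fin.sum_univ_two]; simp [h]⟩; exact ⟨![0, 1], by rw [Fin.sum_univ_two]; simp [h]⟩;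
      exact ⟨![1, 1], by rw [Fin.sum_univ_two]; simp [h]⟩]

/-- Two non-zero distinct vectors of `𝔽₂^m` are linearly independent. -/
theorem linearIndependent_pair {x y : Fin m → ZMod 2} (hx : x ≠ 0) (hy : y ≠ 0) (hxy : x ≠ y) :
    LinearIndependent (ZMod 2) ![x, y] := by
  rw [LinearIndependent.pair_iff' hx]
  intro a
  have ha : a = 0 ∨ a = 1 := by revert a; decide
  rcases ha with rfl | rfl
  · rw [zero_smul]; exact hy.symm
  · rw [one_smul]; exact hxy

/-- Such a pair spans a plane. -/
theorem finrank_span_pair {x y : Fin m → ZMod 2} (hx : x ≠ 0) (hy : y ≠ 0) (hxy : x ≠ y) :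
    finrank (ZMod 2) (Submodule.span (ZMod 2) (Set.range ![x, y])) = 2 := by
  rw [finrank_span_eq_card (linearIndependent_pair hx hy hxy), Fintype.card_fin]

/-- **The four points of the plane through the origin spanned by `x, y`.** -/
def planePts (x y : Fin m → ZMod 2) : Finset (Fin m → Bool) :=
  {toPt 0, toPt x, toPt y, toPt (x + y)}

/-- Membership in `planePts`: the coordinate vector lies in the plane. -/
theorem mem_planePts_iff (x y : Fin m → ZMod 2) (v : Fin m → Bool) :
    v ∈ planePts x y ↔ bvec v ∈ Submodule.span (ZMod 2) (Set.range ![x, y]) := by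
  rw [mem_span_pair_iff]
  unfold planePts
  simp only [Finset.mem_insert, Finset.mem_singleton]
  have key : ∀ z : Fin m → ZMod 2, v = toPt z ↔ bvec v = z := fun z =>
    ⟨fun h => by rw [h, bvec_toPt], fun h => by rw [← h, toPt_bvec]⟩
  rw [key, key, key, key]

/-- `#planePts ≤ 4`. -/
theorem card_planePts_le (x y : Fin m → ZMod 2) : (planePts x y).card ≤ 4 := by
  unfold planePts
  exact (Finset.card_insert_le _ _).trans (Nat.succ_le_succ ((Finset.card_insert_le _ _).trans
    (Nat.succ_le_succ ((Finset.card_insert_le _ _).trans (by rw [Finset.card_singleton])))))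

/-! ### The moment form of a plane -/

/-- `B(x, y) = x yᵀ + y xᵀ`. -/
def bform (x y : Fin m → ZMod 2) : Matrix (Fin m) (Fin m) (ZMod 2) :=
  Matrix.vecMulVec x y + Matrix.vecMulVec y x

/-- `B(x,y)·e = (y·e) x + (x·e) y`. -/
theorem bform_mulVec (x y e : Fin m → ZMod 2) :
    bform x y *ᵥ e = (y ⬝ᵥ e) • x + (x ⬝ᵥ e) • y := by
  unfold bform
  rw [Matrix.add_mulVec, Matrix.vecMulVec_mulVec, Matrix.vecMulVec_mulVec]
  ext i
  simp [mul_comm]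

/-- The quadruple identity in `𝔽₂` (as in `rank_momMat_le_two`). -/
private theorem quad_entry' (a b c a' b' c' : ZMod 2) :
    a * a' + (b * b' + (c * c' + (a + b + c) * (a' + b' + c'))) =
      (a + b) * (a' + c') + (a + c) * (a' + b') := by
  have h2 : (2 : ZMod 2) = 0 := by decide
  linear_combination (b * b' + c * c') * h2

/-- **Structure of a zero-sum quadruple**: `a = {p, q, r, p+q+r}` with `x = p̂ + q̂`, `y = p̂ + r̂`
non-zero and distinct, `momMat (syn2 𝟙_a) = B(x, y)`, and `a = {v : v̂ + p̂ ∈ span{x, y}}`. -/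
theorem quad_structure (a : Finset (Fin m → Bool)) (h4 : a.card = 4)
    (hσ : ∀ i, ∑ v ∈ a, bvec v i = 0) :
    ∃ p ∈ a, ∃ x y : Fin m → ZMod 2, x ≠ 0 ∧ y ≠ 0 ∧ x ≠ y ∧
      momMat (syn2 (indF a)) = bform x y ∧
      ∀ v, v ∈ a ↔ bvec v + bvec p ∈ Submodule.span (ZMod 2) (Set.range ![x, y]) := by
  obtain ⟨p, t, hpt, rfl, ht⟩ := Finset.card_eq_succ.1 h4
  obtain ⟨q, r, s, hqr, hqs, hrs, rfl⟩ := Finset.card_eq_three.1 ht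
  have hpq : p ≠ q := fun h => hpt (by simp [h])
  have hpr : p ≠ r := fun h => hpt (by simp [h])
  have hps : p ≠ s := fun h => hpt (by simp [h])
  -- the point-sum relation
  have hs : ∀ i, bvec s i = bvec p i + bvec q i + bvec r i := by
    intro i
    have h := hσ i
    rw [Finset.sum_insert hpt, Finset.sum_insert (by simp [hqr, hqs]), Finset.sum_pair hrs] at h
    have h' : bvec s i + (bvec p i + bvec q i + bvec r i) = 0 := by rw [← h]; ring
    have key : ∀ u v : ZMod 2, u + v = 0 → u = v := by decide
    exact key _ _ h'
  have hsv : bvec s = bvec p + bvec q + bvec r := funext hs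
  refine ⟨p, Finset.mem_insert_self _ _, bvec p + bvec q, bvec p + bvec r, ?_, ?_, ?_, ?_, ?_⟩
  · intro h
    apply hpq
    apply bvec_injective
    have : bvec p + bvec q + bvec q = bvec q := by rw [h, zero_add]
    rwa [add_assoc, add_self_vec, add_zero] at this
  · intro h
    apply hpr
    apply bvec_injective
    have : bvec p + bvec r + bvec r = bvec r := by rw [h, zero_add]
    rwa [add_assoc, add_self_vec, add_zero] at this
  · intro h
    apply hqr
    apply bvec_injective
    have h' : bvec p + (bvec p + bvec q) = bvec p + (bvec p + bvec r) := by rw [h]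
    rwa [← add_assoc, ← add_assoc, add_self_vec, zero_add, zero_add] at h'
  · -- the moment matrix
    rw [momMat_syn2_indF, Finset.sum_insert hpt, Finset.sum_insert (by simp [hqr, hqs]),
      Finset.sum_pair hrs]
    ext i j
    simp only [Matrix.add_apply, Matrix.vecMulVec_apply, bform, Pi.add_apply, hs]
    exact quad_entry' _ _ _ _ _ _
  · -- membership
    intro v
    rw [mem_span_pair_iff]
    simp only [Finset.mem_insert, Finset.mem_singleton]
    have e0 : bvec v + bvec p = 0 ↔ v = p := by
      constructor
      · intro h
        apply bvec_injective
        have h' : bvec v + bvec p + bvec p = 0 + bvec p := by rw [h]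
        rwa [add_assoc, add_self_vec, add_zero, zero_add] at h'
      · rintro rfl; exact add_self_vec _
    have e1 : ∀ w : Fin m → Bool, bvec v + bvec p = bvec p + bvec w ↔ v = w := by
      intro w
      constructor
      · intro h
        apply bvec_injective
        have h' : bvec p + (bvec v + bvec p) = bvec p + (bvec p + bvec w) := by rw [h]
        rwa [← add_assoc, add_comm (bvec p) (bvec v), add_assoc, add_self_vec, add_zero, ← add_assoc,
          add_self_vec, zero_add] at h'
      · rintro rfl; rw [add_comm]
    have e3 : bvec p + bvec q + (bvec p + bvec r) = bvec p + bvec s := by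
      rw [hsv]
      funext i
      simp only [Pi.add_apply]
      ring
    rw [e0, e1 q, e1 r, e3, e1 s]

/-- **The plane through the origin represents the same coset**: for a zero-sum quadruple
`a = p + span{x, y}`, `𝟙_a + 𝟙_{planePts x y} ∈ RM(m−3, m)` (`0` if `p̂ ∈ span{x,y}`, otherwise the
indicator of the `3`-space `span{x, y, p̂}`, MacWilliams–Sloane Ch.13 Thm 7). -/
theorem indF_add_indF_planePts_mem_lowDeg (hm : 3 ≤ m) {a : Finset (Fin m → Bool)} {p : Fin m → Bool}
    {x y : Fin m → ZMod 2} (hx : x ≠ 0) (hy : y ≠ 0) (hxy : x ≠ y)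
    (ha : ∀ v, v ∈ a ↔ bvec v + bvec p ∈ Submodule.span (ZMod 2) (Set.range ![x, y])) :
    indF a + indF (planePts x y) ∈ lowDeg (ZMod 2) m (m - 3) := by
  classical
  set S := Submodule.span (ZMod 2) (Set.range ![x, y]) with hS
  by_cases hp : bvec p ∈ S
  · -- `a = planePts`
    have heq : indF a + indF (planePts x y) = 0 := by
      funext v
      simp only [Pi.add_apply, Pi.zero_apply, indF, mem_planePts_iff, ← hS]
      have h : v ∈ a ↔ bvec v ∈ S := by
        rw [ha v]
        constructor
        · intro h
          have := S.add_mem h hp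
          rwa [add_assoc, add_self_vec, add_zero] at this
        · intro h; exact S.add_mem h hp
      by_cases hv : bvec v ∈ S
      · rw [if_pos (h.2 hv), if_pos hv]; decide
      · rw [if_neg (fun h' => hv (h.1 h')), if_neg hv]; decide
    rw [heq]
    exact Submodule.zero_mem _
  · -- `a ⊔ planePts = points of span{p̂, x, y}`
    set W := Submodule.span (ZMod 2) (Set.range ![bvec p, x, y]) with hW
    have hWS : ∀ z, z ∈ W ↔ z ∈ S ∨ z + bvec p ∈ S := by
      intro z
      have hrange : Set.range ![bvec p, x, y] = insert (bvec p) (Set.range ![x, y]) := by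
        ext w
        simp only [Set.mem_range, Set.mem_insert_iff]
        constructor
        · rintro ⟨i, rfl⟩
          fin_cases i
          · exact Or.inl rfl
          · exact Or.inr ⟨0, rfl⟩
          · exact Or.inr ⟨1, rfl⟩
        · rintro (rfl | ⟨i, rfl⟩)
          · exact ⟨0, rfl⟩
          · fin_cases i
            · exact ⟨1, rfl⟩
            · exact ⟨2, rfl⟩
      rw [hW, hrange, Submodule.mem_span_insert, ← hS]
      constructor
      · rintro ⟨c, s, hs, rfl⟩
        have hc : c = 0 ∨ c = 1 := by revert c; decide
        rcases hc with rfl | rfl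
        · left; rwa [zero_smul, zero_add]
        · right; rwa [one_smul, add_comm (bvec p) s, add_assoc, add_self_vec, add_zero]
      · rintro (h | h)
        · exact ⟨0, z, h, by rw [zero_smul, zero_add]⟩
        · exact ⟨1, z + bvec p, h, by rw [one_smul, add_comm (bvec p), add_assoc, add_self_vec, add_zero]⟩
    have hnot : ∀ z, ¬ (z ∈ S ∧ z + bvec p ∈ S) := by
      rintro z ⟨h1, h2⟩
      apply hp
      have := S.add_mem h1 h2
      rwa [← add_assoc, add_self_vec, zero_add] at this
    have heq : indF a + indF (planePts x y) =
        fun u : Fin m → Bool => if (fun i => if u i then (1 : ZMod 2) else 0) - 0 ∈ W then (1 : ZMod 2) else 0 := by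
      funext v
      rw [sub_zero]
      have hb : (fun i => if v i then (1 : ZMod 2) else 0) = bvec v := rfl
      rw [hb]
      simp only [Pi.add_apply, indF, mem_planePts_iff, ← hS, ha v, hWS (bvec v)]
      by_cases h1 : bvec v ∈ S <;> by_cases h2 : bvec v + bvec p ∈ S
      · exact absurd ⟨h1, h2⟩ (hnot _)
      · rw [if_neg h2, if_pos h1, if_pos (Or.inl h1)]; decide
      · rw [if_pos h2, if_neg h1, if_pos (Or.inr h2)]; decide
      · rw [if_neg h2, if_neg h1, if_neg (by tauto)]; decide
    rw [heq]
    have hindep : LinearIndependent (ZMod 2) ![bvec p, x, y] := by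
      have h := linearIndependent_finCons (K := ZMod 2) (x := bvec p) (v := ![x, y])
      exact h.2 ⟨linearIndependent_pair hx hy hxy, hp⟩
    have hfin : finrank (ZMod 2) W = 3 := by
      rw [hW, finrank_span_eq_card hindep, Fintype.card_fin]
    exact indicator_coset_mem_lowDeg 0 (m - 3) W (by rw [hfin]; omega)

/-! ### The algebraic clique lemma -/

/-- **If `x, y, x', y'` are linearly independent, `B(x,y) + B(x',y')` has rank `≥ 4`**: every one of
the four vectors is in its range (solve `[y x y' x']·e = e_i`; the `4 × m` matrix has full row rank). -/
theorem four_le_rank_bform_add {x y x' y' : Fin m → ZMod 2}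
    (h : LinearIndependent (ZMod 2) ![x, y, x', y']) :
    4 ≤ (bform x y + bform x' y').rank := by
  classical
  -- the row matrix `N = [y; x; y'; x']` has rank 4, so `N·e` takes every value
  set N : Matrix (Fin 4) (Fin m) (ZMod 2) := ![y, x, y', x'] with hN
  have hNind : LinearIndependent (ZMod 2) N := by
    have hσ : Function.Injective (![1, 0, 3, 2] : Fin 4 → Fin 4) := by decide
    have hc := h.comp _ hσ
    have he : (![x, y, x', y'] ∘ ![1, 0, 3, 2] : Fin 4 → Fin m → ZMod 2) = N := by
      funext i; fin_cases i <;> rfl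
    rw [he] at hc
    exact hc
  have hrank : N.rank = 4 := by
    have h := hNind.rank_matrix
    rw [Fintype.card_fin] at h
    exact h
  have htop : LinearMap.range N.mulVecLin = ⊤ := by
    apply Submodule.eq_top_of_finrank_eq
    rw [Module.finrank_fintype_fun_eq_card, Fintype.card_fin]
    exact hrank
  have hsolve : ∀ t : Fin 4 → ZMod 2, ∃ e : Fin m → ZMod 2, N *ᵥ e = t := by
    intro t
    have ht : t ∈ LinearMap.range N.mulVecLin := by rw [htop]; exact Submodule.mem_top
    obtain ⟨e, he⟩ := LinearMap.mem_range.1 ht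
    exact ⟨e, he⟩
  -- each of `x, y, x', y'` is in the range of `B + B'`
  have hBe : ∀ e, (bform x y + bform x' y') *ᵥ e =
      (y ⬝ᵥ e) • x + (x ⬝ᵥ e) • y + ((y' ⬝ᵥ e) • x' + (x' ⬝ᵥ e) • y') := by
    intro e
    rw [Matrix.add_mulVec, bform_mulVec, bform_mulVec]
  have hN_mul : ∀ e, N *ᵥ e = ![y ⬝ᵥ e, x ⬝ᵥ e, y' ⬝ᵥ e, x' ⬝ᵥ e] := by
    intro e
    funext i
    fin_cases i <;> rfl
  have hrange : ∀ t : Fin 4 → ZMod 2,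
      t 0 • x + t 1 • y + (t 2 • x' + t 3 • y') ∈ LinearMap.range (bform x y + bform x' y').mulVecLin := by
    intro t
    obtain ⟨e, he⟩ := hsolve t
    rw [hN_mul] at he
    have h0 := congrFun he 0; have h1 := congrFun he 1; have h2 := congrFun he 2; have h3 := congrFun he 3
    simp only [Matrix.cons_val_zero, Matrix.cons_val_one, Matrix.cons_val] at h0 h1 h2 h3
    exact LinearMap.mem_range.2 ⟨e, by rw [Matrix.mulVecLin_apply, hBe, h0, h1, h2, h3]⟩
  have hmem : ∀ v ∈ ({x, y, x', y'} : Set (Fin m → ZMod 2)),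
      v ∈ LinearMap.range (bform x y + bform x' y').mulVecLin := by
    intro v hv
    simp only [Set.mem_insert_iff, Set.mem_singleton_iff] at hv
    rcases hv with rfl | rfl | rfl | rfl
    · simpa using hrange ![1, 0, 0, 0]
    · simpa using hrange ![0, 1, 0, 0]
    · simpa using hrange ![0, 0, 1, 0]
    · simpa using hrange ![0, 0, 0, 1]
  have hspan : Submodule.span (ZMod 2) (Set.range ![x, y, x', y']) ≤
      LinearMap.range (bform x y + bform x' y').mulVecLin := by
    rw [Submodule.span_le]
    rintro v ⟨i, rfl⟩
    apply hmem
    fin_cases i <;> simp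
  calc 4 = finrank (ZMod 2) (Submodule.span (ZMod 2) (Set.range ![x, y, x', y'])) := by
        rw [finrank_span_eq_card h, Fintype.card_fin]
    _ ≤ finrank (ZMod 2) (LinearMap.range (bform x y + bform x' y').mulVecLin) :=
        Submodule.finrank_mono hspan
    _ = (bform x y + bform x' y').rank := rfl

/-- **Complementary planes give independent quadruples**: if the pairs `(x, y)`, `(x', y')` are
independent and `span{x,y} ⊓ span{x',y'} = ⊥`, then `x, y, x', y'` are linearly independent. -/
theorem linearIndependent_four {x y x' y' : Fin m → ZMod 2} (hx : x ≠ 0) (hy : y ≠ 0) (hxy : x ≠ y)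
    (hx' : x' ≠ 0) (hy' : y' ≠ 0) (hxy' : x' ≠ y')
    (hbot : Submodule.span (ZMod 2) (Set.range ![x, y]) ⊓ Submodule.span (ZMod 2) (Set.range ![x', y']) = ⊥) :
    LinearIndependent (ZMod 2) ![x, y, x', y'] := by
  rw [Fintype.linearIndependent_iff]
  intro g hg
  rw [Fin.sum_univ_four] at hg
  simp only [Matrix.cons_val_zero, Matrix.cons_val_one, Matrix.cons_val] at hg
  -- `g0 x + g1 y = g2 x' + g3 y'` lies in both planes
  have hmemS : g 0 • x + g 1 • y ∈ Submodule.span (ZMod 2) (Set.range ![x, y]) := by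
    rw [Submodule.mem_span_range_iff_exists_fun]
    exact ⟨![g 0, g 1], by rw [Fin.sum_univ_two]; rfl⟩
  have hmemS' : g 2 • x' + g 3 • y' ∈ Submodule.span (ZMod 2) (Set.range ![x', y']) := by
    rw [Submodule.mem_span_range_iff_exists_fun]
    exact ⟨![g 2, g 3], by rw [Fin.sum_univ_two]; rfl⟩
  have heq : g 0 • x + g 1 • y = g 2 • x' + g 3 • y' := by
    have h2 : (g 0 • x + g 1 • y) + (g 2 • x' + g 3 • y') = 0 := by
      rw [← hg]; abel
    have key : ∀ u v : Fin m → ZMod 2, u + v = 0 → u = v := by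
      intro u v huv
      have h' : u + v + v = 0 + v := by rw [huv]
      rwa [add_assoc, add_self_vec, add_zero, zero_add] at h'
    exact key _ _ h2
  have hin : g 0 • x + g 1 • y ∈ Submodule.span (ZMod 2) (Set.range ![x, y]) ⊓
      Submodule.span (ZMod 2) (Set.range ![x', y']) := ⟨hmemS, by rw [heq]; exact hmemS'⟩
  rw [hbot, Submodule.mem_bot] at hin
  have hin' : g 2 • x' + g 3 • y' = 0 := by rw [← heq]; exact hin
  have h01 := (Fintype.linearIndependent_iff.1 (linearIndependent_pair hx hy hxy)) ![g 0, g 1]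
    (by rw [Fin.sum_univ_two]; exact hin)
  have h23 := (Fintype.linearIndependent_iff.1 (linearIndependent_pair hx' hy' hxy')) ![g 2, g 3]
    (by rw [Fin.sum_univ_two]; exact hin')
  intro i
  fin_cases i <;> [exact h01 0; exact h01 1; exact h23 0; exact h23 1]

end Syndrome2

end Summit.QuantumAdvantage.AdviceFreeQNC0

end
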